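import Summits.ValiantsHypothesis.ValiantsHypothesis.Theorems.LacunarySymmetroidMatrixDescartesStubArith4

/-!
# LINE `valuative_door` (crux `WeakLifting`, stmt-ValiantsHypothesis-19561) — LOCATED REDUCTION: the content stub `ValRankOneLaw`
# AS TYPED (repeated letter exponents allowed) already implies `ValMatrixDescartes`, hence — through the line's own kernel door — the summit

HONEST FRAMING.  Helper (cell `pub-symmetroid`, seat val-sym-lift-p1 g22, 2026-08-29; `--supports 19561 --as helper`).  NOTHING of the summit is
proved here: this file proves an IMPLICATION between two candidate statements of the skeleton `Cruxes/WeakLifting/Lines/valuative_door.lean`,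
both written out def-free: `ValRankOneLaw → ValMatrixDescartes` (`valMatrixDescartes_of_valRankOneLaw_unfolded`).  REASON (elementary): over a
field of characteristic zero every symmetric matrix is a sum of `m` scaled rank-one squares, `S = Σ_{k<m} ε_k w_k w_kᵀ` (orthogonal basis of the
symmetric bilinear form, `LinearMap.BilinForm.exists_orthogonal_basis`; `exists_eq_sum_smul_vecMulVec`), so a GENERAL symmetric lacunary pencil
`Σ_l X^{d_l} S_l` of format `(m, K)` IS a rank-one lacunary pencil of format `(m, K·m)` whose letter exponents are REPEATED `m` times each
(`symmPencil_eq_rankOnePencil`).  `ValRankOneLaw` quantifies over all `K` and all `d` (repeats allowed), so it yields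
`npEdges ≤ (m · (K·m))^C` for EVERY symmetric pencil (`genValRootLaw_of_valRankOneLaw_unfolded`), a polynomial valuative law that sits far
inside the quasi-polynomial budget of `ValMatrixDescartes` (arithmetic: `StubArith4.exp_le`).  CONSEQUENCE FOR THE LINE: with
`stub_pencilTransferPoly` (p701081), `stub_valThetaWitness` (p704458), `stub_twoAdicOnReals` (p701887) kernel, the skeleton's
`valiant_of_valMatrixDescartes` turns `stub_valRankOneLaw` ALONE into VP ≠ VNP — the stub as typed is NOT a rung but summit-strength (it would
in particular give a HYPOTHESIS-FREE polynomial valuative fewnomial bound for all symmetric lacunary determinants).  The honest rank-one rung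
is the injective-exponent case (`valRankOneSharpInj_unfolded`, KERNEL: npEdges ≤ m(K−m)), which does NOT feed this reduction (the reduction
needs repeated exponents).  Planner information, not a claim: `ValRankOneLaw`, `ValMatrixDescartes`, vW, `WeakLifting` 19561, `MatrixDescartes`
18050 and VP ≠ VNP all remain OPEN / NOT proved.  UPDATE AT FILING (2026-08-29T07:34Z–07:40Z, bus): the antecedent `ValRankOneLaw` AS
TYPED is REFUTED ON PAPER (pen val-idea-24 g4, Carstensen read-once bipartite embedding via the tree's
`ParamDAG.exists_superpolynomial_isBreakpoint_natSlope`; critic val-idea-crit-6 g5 VERDICT #64 concurring; Lean refutation = lane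
`…ValuativeDoorRankOneLawFalse`), so `valMatrixDescartes_of_valRankOneLaw_unfolded` is a kernel-true implication with a (paper-)false
antecedent; what stays useful is the UNIVERSALITY step (`exists_eq_sum_smul_vecMulVec`, `symmPencil_eq_rankOnePencil`,
`genValRootLaw_of_valRankOneLaw_unfolded`: any rank-one valuative law with repeats ⇒ the same law for all symmetric pencils), which is also
the reduction that turns any superpolynomial symmetric (or, by `…SymmetryVoid`, general) pencil family into a refutation of the rank-one law.
[elementary linear algebra + bookkeeping]
-/

set_option linter.dupNamespace false
set_option autoImplicit false

namespace Summit.ValiantsHypothesis.ValiantsHypothesis.Theorems.KPlusLogSqLaw.ValDoor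

open Polynomial Finset Matrix
open scoped BigOperators Classical

/-! ## §1 Symmetric matrices are sums of `m` scaled rank-one squares -/

/-- **diagonalisation of symmetric bilinear forms, matrix form:** over a field of characteristic zero every symmetric `m × m` matrix is
`Σ_{k<m} ε_k · w_k w_kᵀ` (some `ε_k` may vanish).  [`LinearMap.BilinForm.exists_orthogonal_basis`; folklore] -/
theorem exists_eq_sum_smul_vecMulVec {F : Type*} [Field F] [CharZero F] {m : ℕ} (S : Matrix (Fin m) (Fin m) F) (hS : S.IsSymm) :
    ∃ (ε : Fin m → F) (w : Fin m → Fin m → F), S = ∑ k, ε k • Matrix.vecMulVec (w k) (w k) := by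
  haveI : Invertible (2 : F) := invertibleOfNonzero two_ne_zero
  set B : LinearMap.BilinForm F (Fin m → F) := Matrix.toBilin' S with hB
  have hBs : B.IsSymm := Matrix.isSymm_toBilin'_iff_isSymm.2 hS
  obtain ⟨b₀, hb₀⟩ := LinearMap.BilinForm.exists_orthogonal_basis (LinearMap.BilinForm.isSymm_iff.1 hBs)
  have hfr : Module.finrank F (Fin m → F) = m := Module.finrank_fin_fun F
  set b : Module.Basis (Fin m) F (Fin m → F) := b₀.reindex (finCongr hfr) with hb
  have hb_apply : ∀ k, b k = b₀ ((finCongr hfr).symm k) := fun k => Module.Basis.reindex_apply _ _ _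
  have horth : ∀ k k' : Fin m, k ≠ k' → B (b k) (b k') = 0 := by
    intro k k' hne
    rw [hb_apply, hb_apply]
    have hne' : (finCongr hfr).symm k ≠ (finCongr hfr).symm k' := fun h => hne ((finCongr hfr).symm.injective h)
    exact hb₀ hne'
  -- expansion in the orthogonal basis
  have hexp : ∀ x y : Fin m → F, B x y = ∑ k, b.repr x k * b.repr y k * B (b k) (b k) := by
    intro x y
    conv_lhs => rw [← b.sum_repr x, ← b.sum_repr y]
    rw [LinearMap.BilinForm.sum_left]
    refine Finset.sum_congr rfl fun k _ => ?_
    rw [LinearMap.BilinForm.sum_right, Finset.sum_eq_single k]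
    · rw [LinearMap.BilinForm.smul_left, LinearMap.BilinForm.smul_right]
      ring
    · intro k' _ hk'
      rw [LinearMap.BilinForm.smul_left, LinearMap.BilinForm.smul_right, horth k k' (Ne.symm hk'), mul_zero, mul_zero]
    · intro h
      exact absurd (Finset.mem_univ k) h
  refine ⟨fun k => B (b k) (b k), fun k i => b.repr (Pi.single i 1) k, ?_⟩
  ext i j
  rw [← Matrix.toBilin'_single S i j]
  change B (Pi.single i 1) (Pi.single j 1) = _
  rw [hexp, Matrix.sum_apply]
  refine Finset.sum_congr rfl fun k _ => ?_
  rw [Matrix.smul_apply, Matrix.vecMulVec_apply, smul_eq_mul]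
  ring

/-! ## §2 A symmetric lacunary pencil is a rank-one lacunary pencil with repeated exponents -/

/-- **format change `(m, K) ↦ (m, K·m)` with each exponent repeated `m` times:** every symmetric lacunary pencil is a rank-one lacunary
pencil on `K·m` letters. [bookkeeping on §1] -/
theorem symmPencil_eq_rankOnePencil {F : Type*} [Field F] [CharZero F] (m K : ℕ) (d : Fin K → ℕ)
    (S : Fin K → Matrix (Fin m) (Fin m) F) (hS : ∀ l, (S l).IsSymm) :
    ∃ (ε : Fin (K * m) → F) (u : Fin (K * m) → Fin m → F),
      (∑ l, ((X : F[X]) ^ d l) • (S l).map (C : F →+* F[X]))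
        = ∑ p, ((X : F[X]) ^ d (finProdFinEquiv.symm p).1) • (ε p • Matrix.vecMulVec (u p) (u p)).map (C : F →+* F[X]) := by
  choose ε w hεw using fun l => exists_eq_sum_smul_vecMulVec (S l) (hS l)
  refine ⟨fun p => ε (finProdFinEquiv.symm p).1 (finProdFinEquiv.symm p).2,
    fun p => w (finProdFinEquiv.symm p).1 (finProdFinEquiv.symm p).2, ?_⟩
  rw [← (finProdFinEquiv : Fin K × Fin m ≃ Fin (K * m)).sum_comp]
  simp only [Equiv.symm_apply_apply]
  rw [Fintype.sum_prod_type]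
  refine Finset.sum_congr rfl fun l _ => ?_
  dsimp only
  conv_lhs => rw [hεw l]
  rw [← Finset.smul_sum]
  congr 1
  rw [← RingHom.mapMatrix_apply, map_sum]
  simp only [RingHom.mapMatrix_apply]

/-- **`ValRankOneLaw` (as typed, repeats allowed) gives a POLYNOMIAL valuative law for ALL symmetric lacunary pencils:**
`npEdges ≤ (m · (K·m))^C` for every format `(m, K)`, every non-archimedean `v` over a field of characteristic zero (both statements
unfolded, the hypothesis is the skeleton's `ValRankOneLaw` body for a fixed `C`). -/
theorem genValRootLaw_of_valRankOneLaw_unfolded (Cst : ℕ)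
    (hR1 : ∀ (F : Type) [Field F] [CharZero F] (v : AbsoluteValue F ℝ), IsNonarchimedean v →
      ∀ (m K : ℕ) (d : Fin K → ℕ) (ε : Fin K → F) (u : Fin K → Fin m → F),
        ((Matrix.det (∑ l, ((Polynomial.X : Polynomial F) ^ d l) •
            (ε l • Matrix.vecMulVec (u l) (u l)).map Polynomial.C)).support.filter fun E => ∃ r : ℝ, 0 < r ∧
            ∀ E' ∈ (Matrix.det (∑ l, ((Polynomial.X : Polynomial F) ^ d l) •
              (ε l • Matrix.vecMulVec (u l) (u l)).map Polynomial.C)).support, E' ≠ E →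
              v ((Matrix.det (∑ l, ((Polynomial.X : Polynomial F) ^ d l) •
                (ε l • Matrix.vecMulVec (u l) (u l)).map Polynomial.C)).coeff E') * r ^ E'
              < v ((Matrix.det (∑ l, ((Polynomial.X : Polynomial F) ^ d l) •
                (ε l • Matrix.vecMulVec (u l) (u l)).map Polynomial.C)).coeff E) * r ^ E).card - 1
          ≤ (m * K) ^ Cst)
    (F : Type) [Field F] [CharZero F] (v : AbsoluteValue F ℝ) (hv : IsNonarchimedean v) (m K : ℕ) (d : Fin K → ℕ)
    (S : Fin K → Matrix (Fin m) (Fin m) F) (hS : ∀ l, (S l).IsSymm) :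
    ((Matrix.det (∑ l, ((Polynomial.X : Polynomial F) ^ d l) • (S l).map Polynomial.C)).support.filter fun E =>
        ∃ r : ℝ, 0 < r ∧ ∀ E' ∈ (Matrix.det (∑ l, ((Polynomial.X : Polynomial F) ^ d l) • (S l).map Polynomial.C)).support,
          E' ≠ E →
          v ((Matrix.det (∑ l, ((Polynomial.X : Polynomial F) ^ d l) • (S l).map Polynomial.C)).coeff E') * r ^ E'
            < v ((Matrix.det (∑ l, ((Polynomial.X : Polynomial F) ^ d l) • (S l).map Polynomial.C)).coeff E) * r ^ E).card - 1
      ≤ (m * (K * m)) ^ Cst := by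
  obtain ⟨ε, u, hpencil⟩ := symmPencil_eq_rankOnePencil m K d S hS
  rw [hpencil]
  exact hR1 F v hv m (K * m) (fun p => d (finProdFinEquiv.symm p).1) ε u

/-! ## §3 … and therefore `ValMatrixDescartes` -/

/-- the exponent arithmetic: `2 (L + c)^c + L + 1 ≤ 3 (L + (c + 1))^{c+1}`. [bookkeeping] -/
theorem two_mul_pow_add_le (L c : ℕ) : 2 * (L + c) ^ c + L + 1 ≤ 3 * (L + (c + 1)) ^ (c + 1) := by
  have h1 : (L + c) ^ c ≤ (L + (c + 1)) ^ (c + 1) :=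
    calc (L + c) ^ c ≤ (L + (c + 1)) ^ c := Nat.pow_le_pow_left (by omega) _
      _ ≤ (L + (c + 1)) ^ (c + 1) := Nat.pow_le_pow_right (by omega) (by omega)
  have h2 : L + 1 ≤ (L + (c + 1)) ^ (c + 1) :=
    calc L + 1 ≤ L + (c + 1) := by omega
      _ = (L + (c + 1)) ^ 1 := (pow_one _).symm
      _ ≤ (L + (c + 1)) ^ (c + 1) := Nat.pow_le_pow_right (by omega) (by omega)
  omega

/-- **`ValRankOneLaw → ValMatrixDescartes`** (both the skeleton's candidates, unfolded): a polynomial bound `(m·(K·m))^C` on every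
symmetric lacunary pencil is far inside the budget `npEdges^q ≤ 2^{K ⌊log₂ K⌋}` for `m ≤ 2^{(⌊log₂ K⌋ + c)^c}`, `K ≥ K₀(c, q, C)`.
Through the skeleton's kernel door `valiant_of_valMatrixDescartes` and the kernel stubs `stub_pencilTransferPoly`, `stub_valThetaWitness`,
`stub_twoAdicOnReals`, this makes `stub_valRankOneLaw` AS TYPED summit-strength.  [bookkeeping: `StubArith4.exp_le`] -/
theorem valMatrixDescartes_of_valRankOneLaw_unfolded
    (hR1 : ∃ Cst : ℕ, ∀ (F : Type) [Field F] [CharZero F] (v : AbsoluteValue F ℝ), IsNonarchimedean v →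
      ∀ (m K : ℕ) (d : Fin K → ℕ) (ε : Fin K → F) (u : Fin K → Fin m → F),
        ((Matrix.det (∑ l, ((Polynomial.X : Polynomial F) ^ d l) •
            (ε l • Matrix.vecMulVec (u l) (u l)).map Polynomial.C)).support.filter fun E => ∃ r : ℝ, 0 < r ∧
            ∀ E' ∈ (Matrix.det (∑ l, ((Polynomial.X : Polynomial F) ^ d l) •
              (ε l • Matrix.vecMulVec (u l) (u l)).map Polynomial.C)).support, E' ≠ E →
              v ((Matrix.det (∑ l, ((Polynomial.X : Polynomial F) ^ d l) •
                (ε l • Matrix.vecMulVec (u l) (u l)).map Polynomial.C)).coeff E') * r ^ E'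
              < v ((Matrix.det (∑ l, ((Polynomial.X : Polynomial F) ^ d l) •
                (ε l • Matrix.vecMulVec (u l) (u l)).map Polynomial.C)).coeff E) * r ^ E).card - 1
          ≤ (m * K) ^ Cst) :
    ∀ c q : ℕ, 0 < q → ∃ K₀ : ℕ, ∀ K m : ℕ, K₀ ≤ K → m ≤ 2 ^ ((Nat.log 2 K + c) ^ c) →
      ∀ (F : Type) [Field F] [CharZero F] (v : AbsoluteValue F ℝ), IsNonarchimedean v →
        ∀ (d : Fin K → ℕ) (S : Fin K → Matrix (Fin m) (Fin m) F), (∀ l, (S l).IsSymm) →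
          (((Matrix.det (∑ l, ((Polynomial.X : Polynomial F) ^ d l) • (S l).map Polynomial.C)).support.filter fun E =>
              ∃ r : ℝ, 0 < r ∧ ∀ E' ∈ (Matrix.det (∑ l, ((Polynomial.X : Polynomial F) ^ d l) • (S l).map Polynomial.C)).support,
                E' ≠ E →
                v ((Matrix.det (∑ l, ((Polynomial.X : Polynomial F) ^ d l) • (S l).map Polynomial.C)).coeff E') * r ^ E'
                  < v ((Matrix.det (∑ l, ((Polynomial.X : Polynomial F) ^ d l) • (S l).map Polynomial.C)).coeff E) * r ^ E).card
            - 1) ^ q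
            ≤ 2 ^ (K * Nat.log 2 K) := by
  obtain ⟨Cst, hC⟩ := hR1
  intro c q _hq
  obtain ⟨K₁, hK₁⟩ := Summit.ValiantsHypothesis.ValiantsHypothesis.Theorems.LacunarySymmetroidMatrixDescartes.StubArith4.exp_le
    (c + 1) (3 * Cst * q)
  refine ⟨K₁, fun K m hK hm F _ _ v hv d S hS => ?_⟩
  have hZ := genValRootLaw_of_valRankOneLaw_unfolded Cst hC F v hv m K d S hS
  set L := Nat.log 2 K with hL
  -- m (K m) ≤ 2^(2P + L + 1), P = (L + c)^c
  have hK2 : K < 2 ^ (L + 1) := Nat.lt_pow_succ_log_self one_lt_two K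
  have hmKm : m * (K * m) ≤ 2 ^ (2 * (L + c) ^ c + L + 1) :=
    calc m * (K * m) = m * m * K := by ring
      _ ≤ 2 ^ (L + c) ^ c * 2 ^ (L + c) ^ c * 2 ^ (L + 1) := Nat.mul_le_mul (Nat.mul_le_mul hm hm) hK2.le
      _ = 2 ^ (2 * (L + c) ^ c + L + 1) := by
        rw [← pow_add, ← pow_add]
        congr 1
        ring
  have hexp : (2 * (L + c) ^ c + L + 1) * (Cst * q) ≤ K * L := by
    have h1 := two_mul_pow_add_le L c
    have h2 := hK₁ K hK
    rw [← hL] at h2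
    calc (2 * (L + c) ^ c + L + 1) * (Cst * q) ≤ 3 * (L + (c + 1)) ^ (c + 1) * (Cst * q) := Nat.mul_le_mul_right _ h1
      _ = 3 * Cst * q * (L + (c + 1)) ^ (c + 1) := by ring
      _ ≤ K * L := h2
  calc _ ≤ ((m * (K * m)) ^ Cst) ^ q := Nat.pow_le_pow_left hZ q
    _ = (m * (K * m)) ^ (Cst * q) := (pow_mul _ _ _).symm
    _ ≤ (2 ^ (2 * (L + c) ^ c + L + 1)) ^ (Cst * q) := Nat.pow_le_pow_left hmKm _
    _ = 2 ^ ((2 * (L + c) ^ c + L + 1) * (Cst * q)) := (pow_mul _ _ _).symm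
    _ ≤ 2 ^ (K * L) := Nat.pow_le_pow_right (by norm_num) hexp

end Summit.ValiantsHypothesis.ValiantsHypothesis.Theorems.KPlusLogSqLaw.ValDoor
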